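import Mathlib
import HarnessLib
import Summits.QuantumFields.YangMills.Theses.UVClassRigidity
import Literature.MathematicalPhysics.QuantumFieldTheory.Balaban1983to89.T3TiltDescent
import Literature.MathematicalPhysics.QuantumFieldTheory.Balaban1983to89.T3UnitScaleTilt

/-!
# Birth skeleton (crux B) of route-QuantumFields-UVClassRigidity — D-0145 ideator ym-r3-idea-1 g4, LINE 2
Stubs `stub_*` (sorry) + the kernel-checked composition `UVRigidity_of` concluding the ROUTE decl by name.
-/

namespace Summit.QuantumFields.YangMills.Cruxes.UVRigidity.UVClassBirth

open MeasureTheory Filter Topology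
open Literature.MathematicalPhysics.QuantumFieldTheory.Balaban1983to89
open Literature.MathematicalPhysics.QuantumFieldTheory.Balaban1983to89.T3ContinuumYM3Torus
open Literature.MathematicalPhysics.QuantumFieldTheory.Balaban1983to89.T3NestedUnitLaws
open Literature.MathematicalPhysics.QuantumFieldTheory.Balaban1983to89.T3UnitLawDensityEML
open Literature.MathematicalPhysics.QuantumFieldTheory.Balaban1983to89.T4Continuum
open Literature.MathematicalPhysics.QuantumFieldTheory.Balaban1983to89.Missing
open Literature.MathematicalPhysics.QuantumFieldTheory.Balaban1983to89.T3TiltDescent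
open Literature.MathematicalPhysics.QuantumFieldTheory.Balaban1983to89.T4GenFunBounds

noncomputable section

/-- `SU(2)` as a type. -/
abbrev SU2 : Type := ↥(Matrix.specialUnitaryGroup (Fin 2) ℂ)

/-- A trajectory of height laws: one measure on the canonical height-`j` configuration space of `F` for every `j`. -/
abbrev Traj (F : T3Family) : Type := (j : ℕ) → Measure (GaugeField (F.P j) 0 SU2)

/-- CONSISTENCY under Bałaban's one-step averaging `descend` (run `j+1`'s first step read on run `j`'s finest lattice). -/
def Consistent (F : T3Family) (μ : Traj F) : Prop :=
  ∀ j : ℕ, IsProbabilityMeasure (μ j) ∧ μ j = Measure.map (descend F ℰp j) (μ (j + 1))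

/-- REALISATION: along the strictly increasing cutoff sequence `θ`, every joint normalised Wilson-loop expectation of the
`(F, γ)` Wilson runs converges to the integral of the unit string observable against the unit law `μ 0`. -/
def Realises (F : T3Family) (γ : ℝ) (θ : ℕ → ℕ) (μ : Traj F) : Prop :=
  StrictMono θ ∧ ∀ os : List (ULoop3 F),
    Tendsto (fun i => (F.scheme ℰp γ).expectAt (θ i) os) atTop
      (𝓝 (∫ u, (os.map fun C => loopAt u (C.1.atLevel 0)).prod ∂(μ 0)))

/-- UV-EQUIVALENCE of two trajectories in the local clustering sense, from height `j₀` on: absolutely continuous height laws with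
densities positive on the small-field set `S_j = {PlaqSmall (δ j)}`, whose LOG-RATIO has (C2) one-bond oscillation `≤ ω j` on `S_j`,
(C3) two-bond second differences `≤ ω j · exp(-κ · dist)` on `S_j` (ℓ¹ torus distance of the bonds' base points, height-`j` lattice
units), and (C4) both give the large-field set mass `≤ η j`. -/
def UVEquiv (F : T3Family) (κ : ℝ) (j₀ : ℕ) (δ ω η : ℕ → ℝ) (μ μ' : Traj F) : Prop :=
  ∀ j : ℕ, j₀ ≤ j → ∃ r r' : GaugeField (F.P j) 0 SU2 → ℝ, Measurable r ∧ Measurable r' ∧ (∀ U, 0 ≤ r U ∧ 0 ≤ r' U) ∧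
    (∀ U, PlaqSmall (δ j) U → 0 < r U ∧ 0 < r' U) ∧
    μ j = (fieldMeasure (F.P j) 0 SU2).withDensity (fun U => ENNReal.ofReal (r U)) ∧
    μ' j = (fieldMeasure (F.P j) 0 SU2).withDensity (fun U => ENNReal.ofReal (r' U)) ∧
    (∀ (b : PBond (F.P j) 0) (U V : GaugeField (F.P j) 0 SU2), PlaqSmall (δ j) U → PlaqSmall (δ j) V →
      (∀ c : PBond (F.P j) 0, c ≠ b → U c = V c) →
      |(Real.log (r U) - Real.log (r' U)) - (Real.log (r V) - Real.log (r' V))| ≤ ω j) ∧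
    (∀ (b b' : PBond (F.P j) 0) (U V W Z : GaugeField (F.P j) 0 SU2), PlaqSmall (δ j) U → PlaqSmall (δ j) V →
      PlaqSmall (δ j) W → PlaqSmall (δ j) Z → (∀ c : PBond (F.P j) 0, c ≠ b → U c = V c) →
      (∀ c : PBond (F.P j) 0, c ≠ b' → U c = W c) → (∀ c : PBond (F.P j) 0, c ≠ b' → V c = Z c) →
      (∀ c : PBond (F.P j) 0, c ≠ b → W c = Z c) →
      |((Real.log (r U) - Real.log (r' U)) - (Real.log (r V) - Real.log (r' V))) -
        ((Real.log (r W) - Real.log (r' W)) - (Real.log (r Z) - Real.log (r' Z)))| ≤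
        ω j * Real.exp (-(κ * (b.src.tdist b'.src : ℝ)))) ∧
    μ j {U | ¬ PlaqSmall (δ j) U} ≤ ENNReal.ofReal (η j) ∧ μ' j {U | ¬ PlaqSmall (δ j) U} ≤ ENNReal.ofReal (η j)

/-! ## BC3 skeleton for crux B `UVRigidity` -/

/-- stub 1 (M, measure theory): CONDITIONING REDUCTION — for consistent trajectories the unit discrepancy is the discrepancy of the
unit push-forwards `(descendTo 0 j)_*` of the height-`j` laws CONDITIONED on any measurable event `S` of co-mass `≤ η ≤ 1/2` under both,
up to `4η` (unit string observables are bounded by `1`; `μ 0 = (descendTo 0 j)_* (μ j)` by consistency). -/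
theorem stub_conditioningReduction :
    ∀ (F : T3Family) (μ μ' : Traj F), Consistent F μ → Consistent F μ' →
      ∀ (j : ℕ) (S : Set (GaugeField (F.P j) 0 SU2)) (η : ℝ), MeasurableSet S → 0 ≤ η → η ≤ 1 / 2 →
        μ j Sᶜ ≤ ENNReal.ofReal η → μ' j Sᶜ ≤ ENNReal.ofReal η →
        ∀ os : List (ULoop3 F),
          |(∫ u, (os.map fun C => loopAt u (C.1.atLevel 0)).prod ∂(μ 0)) -
              ∫ u, (os.map fun C => loopAt u (C.1.atLevel 0)).prod ∂(μ' 0)| ≤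
            |(∫ U, (os.map fun C => loopAt (descendTo F ℰp 0 j (Nat.zero_le j) U) (C.1.atLevel 0)).prod ∂(ProbabilityTheory.cond (μ j) S)) -
                ∫ U, (os.map fun C => loopAt (descendTo F ℰp 0 j (Nat.zero_le j) U) (C.1.atLevel 0)).prod ∂(ProbabilityTheory.cond (μ' j) S)|
              + 4 * η := by
  sorry

/-- stub 2 (XL, the heart): SMALL-FIELD RIGIDITY — along a realised consistent trajectory, a UV-equivalent consistent trajectory has, at every
height `j ≥ j₀`, small-field-conditioned unit push-forwards within `C · (ω j + η j)` of the first one's (marginal pinning of the coupling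
direction by `ω j → 0`; contraction `L^{-(j - height)}` of the irrelevant directions; (C3) excludes IR reweightings). -/
theorem stub_smallFieldRigidity :
    ∃ γ₁ : ℝ, 0 < γ₁ ∧ ∀ (F : T3Family) (γ : ℝ), 0 < γ → γ ≤ γ₁ →
      ∀ (κ : ℝ) (j₀ : ℕ) (δ ω η : ℕ → ℝ), 0 < κ → (∀ j, 0 < δ j ∧ 0 ≤ ω j ∧ 0 ≤ η j) → Summable ω → Summable η →
        ∀ (θ : ℕ → ℕ) (μ μ' : Traj F), Consistent F μ → Consistent F μ' → Realises F γ θ μ → UVEquiv F κ j₀ δ ω η μ μ' →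
          ∀ os : List (ULoop3 F), ∃ C : ℝ, ∀ j : ℕ, j₀ ≤ j →
            |(∫ U, (os.map fun C => loopAt (descendTo F ℰp 0 j (Nat.zero_le j) U) (C.1.atLevel 0)).prod
                  ∂(ProbabilityTheory.cond (μ j) {U | PlaqSmall (δ j) U})) -
                ∫ U, (os.map fun C => loopAt (descendTo F ℰp 0 j (Nat.zero_le j) U) (C.1.atLevel 0)).prod
                  ∂(ProbabilityTheory.cond (μ' j) {U | PlaqSmall (δ j) U})| ≤ C * (ω j + η j) := by
  sorry

/-- Composition: conditioning reduction + small-field rigidity + `ω j + η j → 0` give crux B. -/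
theorem UVRigidity_of : Summit.QuantumFields.YangMills.Theses.UVClassRigidity.UVRigidity := by
  have h1 := stub_conditioningReduction
  have h2 := stub_smallFieldRigidity
  obtain ⟨γ₁, hγ₁, h2⟩ := h2
  refine ⟨γ₁, hγ₁, fun F γ hγ hle κ j₀ δ ω η hκ hpos hω hη θ μ μ' hc hc' hr huv os => ?_⟩
  obtain ⟨C, hC⟩ := h2 F γ hγ hle κ j₀ δ ω η hκ hpos hω hη θ μ μ' hc hc' hr huv os
  -- the parameters vanish
  have hω0 : Tendsto ω atTop (𝓝 0) := hω.tendsto_atTop_zero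
  have hη0 : Tendsto η atTop (𝓝 0) := hη.tendsto_atTop_zero
  set a : ℝ := ∫ u, (os.map fun C => loopAt u (C.1.atLevel 0)).prod ∂(μ 0) with ha
  set b : ℝ := ∫ u, (os.map fun C => loopAt u (C.1.atLevel 0)).prod ∂(μ' 0) with hb
  -- bound |a - b| ≤ C (ω j + η j) + 4 η j eventually
  have hbound : ∀ᶠ j in atTop, |a - b| ≤ C * (ω j + η j) + 4 * η j := by
    have hηsmall : ∀ᶠ j in atTop, η j ≤ 1 / 2 := by
      have := hη0.eventually (Iic_mem_nhds (show (0 : ℝ) < 1 / 2 by norm_num))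
      exact this
    filter_upwards [hηsmall, eventually_ge_atTop j₀] with j hj hjj
    have hS : MeasurableSet {U : GaugeField (F.P j) 0 SU2 | PlaqSmall (δ j) U} :=
      Literature.MathematicalPhysics.QuantumFieldTheory.Balaban1983to89.T3UnitScaleTilt.measurableSet_plaqSmall (P := F.P j) (j := 0) (G := SU2) (δ j)
    obtain ⟨r, r', -, -, -, -, -, -, -, -, hm, hm'⟩ := huv j hjj
    have hcompl : ({U : GaugeField (F.P j) 0 SU2 | PlaqSmall (δ j) U})ᶜ = {U | ¬ PlaqSmall (δ j) U} := by
      ext U; simp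
    have e1 := h1 F μ μ' hc hc' j {U | PlaqSmall (δ j) U} (η j) hS (hpos j).2.2 hj (hcompl ▸ hm) (hcompl ▸ hm') os
    have e2 := hC j hjj
    linarith
  have hlim : Tendsto (fun j => C * (ω j + η j) + 4 * η j) atTop (𝓝 0) := by
    have := ((hω0.add hη0).const_mul C).add (hη0.const_mul 4)
    simpa using this
  have hle0 : |a - b| ≤ 0 := ge_of_tendsto hlim hbound
  have : |a - b| = 0 := le_antisymm hle0 (abs_nonneg _)
  exact eq_of_abs_sub_eq_zero this |> fun h => by simpa [ha, hb] using h


/-! ## BC5 plan-only rung of crux B (first prover target; not used by `UVRigidity_of`) -/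

/-- BC5 rung (plan-only; the lever's first test, named in Kill criteria): UV-EQUIVALENCE PINS THE COUPLING — realised consistent
trajectories of two DIFFERENT couplings `γ ≠ γ'` of the same family are never UV-equivalent with summable parameters. Technique: asymptotic
freedom at height `j` — the conditional plaquette law at height `j` has width `∝ g_j = (γ L^{-j})^{1/2}`, so the log-ratio of the two height-`j`
densities has one-bond oscillation bounded BELOW by `c · |1 - γ/γ'|` on the all-small set, contradicting `ω j → 0`
([Balaban1985UV3] §3 small-field effective action, leading term). -/
theorem stub_rung_couplingPinning :
    ∃ γ₁ : ℝ, 0 < γ₁ ∧ ∀ (F : T3Family) (γ γ' : ℝ), 0 < γ → γ ≤ γ₁ → 0 < γ' → γ' ≤ γ₁ → γ ≠ γ' →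
      ∀ (κ : ℝ) (j₀ : ℕ) (δ ω η : ℕ → ℝ), 0 < κ → (∀ j, 0 < δ j ∧ 0 ≤ ω j ∧ 0 ≤ η j) → Summable ω → Summable η →
        ∀ (θ θ' : ℕ → ℕ) (μ μ' : Traj F), Consistent F μ → Consistent F μ' → Realises F γ θ μ → Realises F γ' θ' μ' →
          ¬ UVEquiv F κ j₀ δ ω η μ μ' := by
  sorry

end

end Summit.QuantumFields.YangMills.Cruxes.UVRigidity.UVClassBirth
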